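import Mathlib
import Literature.Probability.Percolation.EnhancementProp42
import HarnessLib

/-!
# Uniform diminishment on `ℤ³` (1/8): toolkit — translated boxes, walk decompositions

Helper file for item `stmt-CriticalPhenomena-7206` (`PercBurnResprinkle.UniformDiminishment`, the quenched,
uniform Aizenman–Grimmett diminishment on `ℤ³`), landed with `--supports stmt-CriticalPhenomena-7206`.
The proof runs the in-tree Aizenman–Grimmett engine (`Literature.Probability.Percolation.AGLine`, after
Martineau–Severo 2019 §6) for the two-parameter model "edges open with probability `p`, points of the
thinned deleted set restored with probability `s`"; no definitions are introduced — the available-edge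
map `av` and the exit event `A` enter through characterising hypotheses (`hav`, `hA`).

Contents: membership in translated sup-boxes `(box 3 n).image (· + c)` and coordinates of adjacent
sites; first-entrance / last-exit decompositions of walks with respect to a vertex set, and the
"two distinct vertices of `Q` on a path" lemmas used to separate entrance and exit points; a walk all
of whose edges lie in `ω` is a walk of `openGraph ω`.
-/

namespace Summit.CriticalPhenomena.PercolationContinuityZ3.Theorems

open Literature.Probability.Percolation Literature.Probability.LatticeModels

namespace UnifDim

/-! ### Translated sup-boxes and adjacency in `ℤ³` -/

/-- Membership in the translate `c + box 3 n` of the centred cube. -/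
theorem mem_image_add_box {n : ℕ} {c v : Site 3} :
    v ∈ (box 3 n).image (· + c) ↔ v - c ∈ box 3 n := by
  constructor
  · intro h
    obtain ⟨w, hw, rfl⟩ := Finset.mem_image.1 h
    simpa using hw
  · intro h
    exact Finset.mem_image.2 ⟨v - c, h, sub_add_cancel v c⟩

/-- Coordinates of `v - c` (pointwise subtraction). -/
theorem sub_apply_site (v c : Site 3) (i : Fin 3) : (v - c) i = v i - c i := rfl

/-- Membership in a translated sup-box, coordinatewise. -/
theorem sub_mem_box_iff {n : ℕ} {c v : Site 3} :
    v - c ∈ box 3 n ↔ ∀ i, -(n : ℤ) ≤ v i - c i ∧ v i - c i ≤ n := by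
  rw [mem_box]; rfl

/-- Translated sup-boxes are symmetric: `x ∈ d + box n ↔ d ∈ x + box n`. -/
theorem sub_mem_box_comm {n : ℕ} {x d : Site 3} (h : x - d ∈ box 3 n) : d - x ∈ box 3 n := by
  rw [sub_mem_box_iff] at h ⊢
  intro i
  have := h i
  constructor <;> linarith [this.1, this.2]

/-- `v + eᵢ` is a neighbour of `v` in `ℤ³`. -/
theorem adj_add_single (v : Site 3) (i : Fin 3) : (zdGraph 3).Adj v (v + Pi.single i 1) :=
  (zdGraph_adj_iff _ _).2 ⟨i, Or.inl rfl⟩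

/-- Adjacent sites of `ℤ³` differ by at most one in every coordinate. -/
theorem coord_sub_of_adj {x y : Site 3} (h : (zdGraph 3).Adj x y) (j : Fin 3) :
    -1 ≤ y j - x j ∧ y j - x j ≤ 1 := by
  obtain ⟨i, h | h⟩ := (zdGraph_adj_iff x y).1 h
  · rw [h, Pi.add_apply, Pi.single_apply]
    split_ifs <;> simp
  · rw [h, Pi.add_apply, Pi.single_apply]
    split_ifs <;> simp

/-- Adjacent sites of `ℤ³` agree in all coordinates but one. -/
theorem exists_coord_eq_of_adj {x y : Site 3} (h : (zdGraph 3).Adj x y) :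
    ∃ i : Fin 3, ∀ j, j ≠ i → y j = x j := by
  obtain ⟨i, h | h⟩ := (zdGraph_adj_iff x y).1 h
  · refine ⟨i, fun j hj => ?_⟩
    rw [h, Pi.add_apply, Pi.single_apply, if_neg hj, add_zero]
  · refine ⟨i, fun j hj => ?_⟩
    rw [h, Pi.add_apply, Pi.single_apply, if_neg hj, add_zero]

/-- A neighbour of a point of the sup-box of radius `n` around `c` lies in the box of radius `n + 1`. -/
theorem sub_mem_box_succ_of_adj {n : ℕ} {c x y : Site 3} (hx : x - c ∈ box 3 n)
    (h : (zdGraph 3).Adj x y) : y - c ∈ box 3 (n + 1) := by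
  rw [sub_mem_box_iff] at hx ⊢
  intro i
  have h1 := coord_sub_of_adj h i
  have h2 := hx i
  push_cast
  constructor <;> linarith [h1.1, h1.2, h2.1, h2.2]

/-! ### Walk decompositions -/

section Walks

variable {V : Type*} {G' : SimpleGraph V}

/-- **First entrance.** A walk from outside `Q` to a vertex of `Q` splits at its first vertex in `Q`:
`w = w₁ ++ (a₀ → a) ++ w₂` with `w₁` avoiding `Q` and `a ∈ Q`. -/
theorem exists_first_entrance (Q : Set V) {u v : V} (w : G'.Walk u v) (hu : u ∉ Q) (hv : v ∈ Q) :
    ∃ a₀ a, ∃ (w₁ : G'.Walk u a₀) (h : G'.Adj a₀ a) (w₂ : G'.Walk a v),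
      w = w₁.append (SimpleGraph.Walk.cons h w₂) ∧ (∀ z ∈ w₁.support, z ∉ Q) ∧ a ∈ Q := by
  induction w with
  | nil => exact absurd hv hu
  | @cons x y z hxy w' ih =>
    by_cases hy : y ∈ Q
    · exact ⟨x, y, SimpleGraph.Walk.nil, hxy, w', rfl, by simpa using hu, hy⟩
    · obtain ⟨a₀, a, w₁, h, w₂, hw, hw₁, ha⟩ := ih hy hv
      refine ⟨a₀, a, SimpleGraph.Walk.cons hxy w₁, h, w₂, by rw [hw]; rfl, ?_, ha⟩
      intro t ht
      rw [SimpleGraph.Walk.support_cons, List.mem_cons] at ht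
      rcases ht with rfl | ht
      · exact hu
      · exact hw₁ t ht

/-- **Last exit.** A walk from a vertex of `Q` to a vertex outside `Q` splits at its last vertex in
`Q`: `w = w₁ ++ (b → b₁) ++ w₂` with `w₂` avoiding `Q` and `b ∈ Q`. -/
theorem exists_last_exit (Q : Set V) {u v : V} (w : G'.Walk u v) (hu : u ∈ Q) (hv : v ∉ Q) :
    ∃ b b₁, ∃ (w₁ : G'.Walk u b) (h : G'.Adj b b₁) (w₂ : G'.Walk b₁ v),
      w = w₁.append (SimpleGraph.Walk.cons h w₂) ∧ (∀ z ∈ w₂.support, z ∉ Q) ∧ b ∈ Q := by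
  obtain ⟨a₀, a, w₁, h, w₂, hw, hw₁, ha⟩ := exists_first_entrance Q w.reverse hv hu
  refine ⟨a, a₀, w₂.reverse, h.symm, w₁.reverse, ?_, ?_, ha⟩
  · have hrev := congrArg SimpleGraph.Walk.reverse hw
    rw [SimpleGraph.Walk.reverse_reverse] at hrev
    rw [hrev, SimpleGraph.Walk.reverse_append, SimpleGraph.Walk.reverse_cons,
      ← SimpleGraph.Walk.append_assoc]
    rfl
  · intro z hz
    rw [SimpleGraph.Walk.support_reverse, List.mem_reverse] at hz
    exact hw₁ z hz

/-- A walk all of whose edges belong to `ω` is a walk of the open graph of `ω`. -/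
theorem reachable_openGraph_of_edges {ω : Set (Sym2 V)} {u v : V} (w : G'.Walk u v)
    (h : ∀ f ∈ w.edges, f ∈ ω) : (openGraph ω).Reachable u v := by
  induction w with
  | nil => rfl
  | @cons x y z hxy w' ih =>
    have hxy' : (openGraph ω).Adj x y :=
      (openGraph_adj ω x y).2 ⟨h _ (by simp), hxy.ne⟩
    exact hxy'.reachable.trans (ih fun f hf => h f (by simp [hf]))

/-- In a path `w₁ ++ (a₀ → a) ++ w₂ ++ (b → b₁) ++ w₃` whose outer pieces `w₁, w₃` avoid `Q`, if two
distinct vertices of `Q` lie on the path then `a ≠ b`. (If `a = b` the middle piece is a closed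
sub-path, hence trivial, and the path meets `Q` in `a` only.) -/
theorem ne_of_two_mem {Q : Set V} {u a₀ a b b₁ v : V} (w₁ : G'.Walk u a₀) (ha : G'.Adj a₀ a)
    (w₂ : G'.Walk a b) (hb : G'.Adj b b₁) (w₃ : G'.Walk b₁ v)
    (hpath : (w₁.append (SimpleGraph.Walk.cons ha (w₂.append (SimpleGraph.Walk.cons hb w₃)))).IsPath)
    (hw₁ : ∀ z ∈ w₁.support, z ∉ Q) (hw₃ : ∀ z ∈ w₃.support, z ∉ Q)
    {x x' : V} (hx : x ∈ Q) (hx' : x' ∈ Q) (hxx' : x ≠ x')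
    (hxs : x ∈ (w₁.append (SimpleGraph.Walk.cons ha (w₂.append (SimpleGraph.Walk.cons hb w₃)))).support)
    (hxs' : x' ∈ (w₁.append (SimpleGraph.Walk.cons ha (w₂.append (SimpleGraph.Walk.cons hb w₃)))).support) :
    a ≠ b := by
  intro hab
  subst hab
  -- the closed piece `w₂` of a path is trivial
  have h2 : w₂.IsPath := (hpath.of_append_right.of_cons).of_append_left
  have hnil : w₂.Nil := SimpleGraph.Walk.isPath_iff_nil.1 h2
  have hsupp2 : w₂.support = [a] := SimpleGraph.Walk.nil_iff_support_eq.1 hnil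
  -- every vertex of the path in `Q` equals `a`
  have key : ∀ y ∈ (w₁.append (SimpleGraph.Walk.cons ha (w₂.append (SimpleGraph.Walk.cons hb w₃)))).support,
      y ∈ Q → y = a := by
    intro y hy hyQ
    rw [SimpleGraph.Walk.mem_support_append_iff, SimpleGraph.Walk.support_cons, List.mem_cons,
      SimpleGraph.Walk.mem_support_append_iff, SimpleGraph.Walk.support_cons, List.mem_cons, hsupp2,
      List.mem_singleton] at hy
    rcases hy with hy | rfl | rfl | rfl | hy
    · exact absurd hyQ (hw₁ y hy)
    · exact absurd hyQ (hw₁ _ w₁.end_mem_support)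
    · rfl
    · rfl
    · exact absurd hyQ (hw₃ y hy)
  exact hxx' ((key x hxs hx).trans (key x' hxs' hx').symm)

/-- Variant of `ne_of_two_mem` when the path starts inside `Q` at `a` (no entrance piece):
in a path `w₂ ++ (b → b₁) ++ w₃` from `a` with `w₃` avoiding `Q`, two distinct vertices of `Q` on the
path force `a ≠ b`. -/
theorem ne_of_two_mem' {Q : Set V} {a b b₁ v : V} (w₂ : G'.Walk a b) (hb : G'.Adj b b₁)
    (w₃ : G'.Walk b₁ v) (hpath : (w₂.append (SimpleGraph.Walk.cons hb w₃)).IsPath)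
    (hw₃ : ∀ z ∈ w₃.support, z ∉ Q) {x x' : V} (hx : x ∈ Q) (hx' : x' ∈ Q) (hxx' : x ≠ x')
    (hxs : x ∈ (w₂.append (SimpleGraph.Walk.cons hb w₃)).support)
    (hxs' : x' ∈ (w₂.append (SimpleGraph.Walk.cons hb w₃)).support) : a ≠ b := by
  intro hab
  subst hab
  have h2 : w₂.IsPath := hpath.of_append_left
  have hnil : w₂.Nil := SimpleGraph.Walk.isPath_iff_nil.1 h2
  have hsupp2 : w₂.support = [a] := SimpleGraph.Walk.nil_iff_support_eq.1 hnil
  have key : ∀ y ∈ (w₂.append (SimpleGraph.Walk.cons hb w₃)).support, y ∈ Q → y = a := by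
    intro y hy hyQ
    rw [SimpleGraph.Walk.mem_support_append_iff, SimpleGraph.Walk.support_cons, List.mem_cons, hsupp2,
      List.mem_singleton] at hy
    rcases hy with rfl | rfl | hy
    · rfl
    · rfl
    · exact absurd hyQ (hw₃ y hy)
  exact hxx' ((key x hxs hx).trans (key x' hxs' hx').symm)


/-- **First entrance** (general form): a walk from outside `Q` meeting `Q` splits at its first vertex
in `Q`. -/
theorem exists_first_entrance' (Q : Set V) {u v : V} (w : G'.Walk u v) (hu : u ∉ Q)
    (hv : ∃ z ∈ w.support, z ∈ Q) :
    ∃ a₀ a, ∃ (w₁ : G'.Walk u a₀) (h : G'.Adj a₀ a) (w₂ : G'.Walk a v),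
      w = w₁.append (SimpleGraph.Walk.cons h w₂) ∧ (∀ z ∈ w₁.support, z ∉ Q) ∧ a ∈ Q := by
  induction w with
  | nil =>
    obtain ⟨z, hz, hzQ⟩ := hv
    rw [SimpleGraph.Walk.support_nil, List.mem_singleton] at hz
    subst hz
    exact absurd hzQ hu
  | @cons x y z hxy w' ih =>
    by_cases hy : y ∈ Q
    · exact ⟨x, y, SimpleGraph.Walk.nil, hxy, w', rfl, by simpa using hu, hy⟩
    · have hv' : ∃ z ∈ w'.support, z ∈ Q := by
        obtain ⟨t, ht, htQ⟩ := hv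
        rw [SimpleGraph.Walk.support_cons, List.mem_cons] at ht
        rcases ht with rfl | ht
        · exact absurd htQ hu
        · exact ⟨t, ht, htQ⟩
      obtain ⟨a₀, a, w₁, h, w₂, hw, hw₁, ha⟩ := ih hy hv'
      refine ⟨a₀, a, SimpleGraph.Walk.cons hxy w₁, h, w₂, by rw [hw]; rfl, ?_, ha⟩
      intro t ht
      rw [SimpleGraph.Walk.support_cons, List.mem_cons] at ht
      rcases ht with rfl | ht
      · exact hu
      · exact hw₁ t ht

/-- **Last exit** (general form): a walk meeting `Q` and ending outside `Q` splits at its last vertex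
in `Q`. -/
theorem exists_last_exit' (Q : Set V) {u v : V} (w : G'.Walk u v) (hu : ∃ z ∈ w.support, z ∈ Q)
    (hv : v ∉ Q) :
    ∃ b b₁, ∃ (w₁ : G'.Walk u b) (h : G'.Adj b b₁) (w₂ : G'.Walk b₁ v),
      w = w₁.append (SimpleGraph.Walk.cons h w₂) ∧ (∀ z ∈ w₂.support, z ∉ Q) ∧ b ∈ Q := by
  have hu' : ∃ z ∈ w.reverse.support, z ∈ Q := by
    obtain ⟨z, hz, hzQ⟩ := hu
    exact ⟨z, by rw [SimpleGraph.Walk.support_reverse, List.mem_reverse]; exact hz, hzQ⟩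
  obtain ⟨a₀, a, w₁, h, w₂, hw, hw₁, ha⟩ := exists_first_entrance' Q w.reverse hv hu'
  refine ⟨a, a₀, w₂.reverse, h.symm, w₁.reverse, ?_, ?_, ha⟩
  · have hrev := congrArg SimpleGraph.Walk.reverse hw
    rw [SimpleGraph.Walk.reverse_reverse] at hrev
    rw [hrev, SimpleGraph.Walk.reverse_append, SimpleGraph.Walk.reverse_cons,
      ← SimpleGraph.Walk.append_assoc]
    rfl
  · intro z hz
    rw [SimpleGraph.Walk.support_reverse, List.mem_reverse] at hz
    exact hw₁ z hz

/-- In a path `w₁ ++ (a₀ → a) ++ w₂` with `w₁` avoiding `Q`, two distinct vertices of `Q` on the path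
force `a` to differ from the final vertex (else `w₂` is a closed sub-path, hence trivial). -/
theorem ne_end_of_two_mem {Q : Set V} {u a₀ a v : V} (w₁ : G'.Walk u a₀) (ha : G'.Adj a₀ a)
    (w₂ : G'.Walk a v) (hpath : (w₁.append (SimpleGraph.Walk.cons ha w₂)).IsPath)
    (hw₁ : ∀ z ∈ w₁.support, z ∉ Q) {x x' : V} (hx : x ∈ Q) (hx' : x' ∈ Q) (hxx' : x ≠ x')
    (hxs : x ∈ (w₁.append (SimpleGraph.Walk.cons ha w₂)).support)
    (hxs' : x' ∈ (w₁.append (SimpleGraph.Walk.cons ha w₂)).support) : a ≠ v := by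
  intro hav
  subst hav
  have h2 : w₂.IsPath := hpath.of_append_right.of_cons
  have hnil : w₂.Nil := SimpleGraph.Walk.isPath_iff_nil.1 h2
  have hsupp2 : w₂.support = [a] := SimpleGraph.Walk.nil_iff_support_eq.1 hnil
  have key : ∀ y ∈ (w₁.append (SimpleGraph.Walk.cons ha w₂)).support, y ∈ Q → y = a := by
    intro y hy hyQ
    rw [SimpleGraph.Walk.mem_support_append_iff, SimpleGraph.Walk.support_cons, List.mem_cons, hsupp2,
      List.mem_singleton] at hy
    rcases hy with hy | rfl | rfl
    · exact absurd hyQ (hw₁ y hy)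
    · exact absurd hyQ (hw₁ _ w₁.end_mem_support)
    · rfl
  exact hxx' ((key x hxs hx).trans (key x' hxs' hx').symm)

end Walks

end UnifDim

end Summit.CriticalPhenomena.PercolationContinuityZ3.Theorems
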